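import Summits.AtomisticToContinuum.BoseEinsteinCondensation.Theorems.StaticResponseBound.Negative.Basic
import Summits.AtomisticToContinuum.BoseEinsteinCondensation.Theorems.StaticResponseBound.Negative.CellToolkit
import Summits.AtomisticToContinuum.BoseEinsteinCondensation.Theorems.StaticResponseBound.Negative.UvThomsonStubMutations
import Literature.MathematicalPhysics.QuantumManyBody.LangevinGenerator

/-!
# Negative lemmas for crux `StaticResponseBound` (stmt-AtomisticToContinuum-12057) — IV:
# the free displacement flow is a gradient (part A: the flow potential and its calculus)

Supports (does not close) stmt-AtomisticToContinuum-12057.  Refuter (drefute, generation 2)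
by-products for the picked line `Cruxes/StaticResponseBound/Lines/uv-thomson-force-wave.lean`
(active skeleton 3398ea4f…, stubs S1–S6).  Everything is sorry-free; axioms standard.
Part A (this file): §1 `H₋₁` triangle inequality, §2–§3 the flow potential and its calculus.
Part B (`UvThomsonFlowReduction.lean`): §4–§6, the force-wave identity, S4 for positive weights, converse.

The one observation behind the file: the card's free displacement flow `Yⱼ = sin θ_k(xⱼ) p̂`
(`θ_k(x) = 2πk·x/L`) is a GRADIENT, `Y = ∇f` with the flow potential `f = −|p|⁻¹ ∑ⱼ cos θ_k(xⱼ)`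
(`flowPot`), and `Δf = |p| V_p` (`V_p = ∑ⱼ cos θ_k(xⱼ)`, `densityWave`).  Hence for a `C¹` nonvanishing
weight `F` the Langevin generator gives, pointwise, `L_F f = Δf + ∇log F²·∇f = |p| V_p + Q_F`
(`langevinGen_flowPot`), where `Q_F = (Y·∇F²)/F²` is the line's FORCE-DENSITY WAVE (`forceWaveW`; for
`F = |Φ|` verbatim the skeleton's `forceWave`).  With the tree's Green identity
(`IsWeakCorrector.of_langevinGen`): `‖L_F f‖²₋₁ = 𝓔_F(f,f) = ∫ ∑ⱼ sin² θ_k(xⱼ) F² ≤ N ∫F²`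
(`hMinusOneSqW_langevinGen_flowPot`, `_le`), `∫ Q_F F² = −|p| ∫ V_p F²` (centring), and the `H₋₁`
triangle inequality (`hMinusOneSqW_add_le`, §1) yields BOTH directions at once:

* `thomsonReduction_weight` / `thomsonReduction_pos` — **stub S4 `ThomsonReduction` in the case the
  glue `kineticBranch_of` consumes it** (real, everywhere-positive `Φ`, i.e. S5's ground states):
  `‖Q_Φ − Q̄‖²₋₁ ≤ B ⇒ ‖V_p − V̄‖²₋₁ ≤ (√N + √B)²/|p|²`.  `thomsonReduction_pos` is VERBATIM the
  registered text of `stub_thomsonReduction` with S5's two binders `(∀ X, Φ.ψ X = ‖Φ.ψ X‖) →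
  (∀ X, Φ.ψ X ≠ 0) →` inserted (candidate proof for the lead: reshape S4 to this signature, or extend
  to weights with zeros by the direct weak integration by parts — only that step is missing here).
* `forceWave_le_of_susceptibility` / `_pos` — **the converse**: `‖V_p − V̄‖²₋₁ ≤ B ⇒
  ‖Q_Φ − Q̄‖²₋₁ ≤ (√N + |p|√B)²`.  Consequently S5 `UvForceWaveBound` is EQUIVALENT, with constants
  `(1 + √·)²` each way, to the susceptibility bound `|p|² ‖V_p − V̄‖²_{H₋₁(Φ_s²)} ≤ K′N` for the same
  weakly modulated ground states `Φ_s` of the truncated potentials: the force-wave dress is a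
  bijection of statements, S5 carries exactly the `t → 0` (curvature-at-every-weak-coupling) content
  of the crux's UV half — information for the lead and the planner, not a defect.

Calculus (§2–§3): `argN`, `pderiv_cos_arg`, `pderiv_sin_arg`, `pderiv_flowPot_eq_khat` (`∇f = Y`),
`configLaplacian_flowPot` (`Δf = |p|V_p`), `gradDot_flowPot_self` (`|∇f|² = ∑ⱼ sin² θ(xⱼ) ≤ N`).
-/

namespace Summit.AtomisticToContinuum.BoseEinsteinCondensation.Theorems.StaticResponseBound.Negative.UvThomsonFlow

open MeasureTheory
open scoped ENNReal
open Literature.MathematicalPhysics.QuantumManyBody.BoseGas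
open Summit.AtomisticToContinuum.BoseEinsteinCondensation.Theorems.StaticResponseBound.Negative

noncomputable section

variable {N : ℕ}

/-! ## §1  The `H₋₁` norm is a seminorm: triangle inequality in criterion form -/

/-- **Triangle inequality for the Kipnis–Varadhan `H₋₁` norm** (criterion form): if
`‖g₁‖²₋₁ ≤ C₁` and `‖g₂‖²₋₁ ≤ C₂` then `‖g₁ + g₂‖²₋₁ ≤ (√C₁ + √C₂)²` (continuity of the data makes
every pairing a genuine Bochner integral, so the pairing of the sum splits). [folklore] -/
theorem hMinusOneSqW_add_le {L : ℝ} {F g₁ g₂ : Config N → ℝ} (hF : Continuous F)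
    (hg₁ : Continuous g₁) (hg₂ : Continuous g₂) {C₁ C₂ : ℝ} (hC₁ : 0 ≤ C₁) (hC₂ : 0 ≤ C₂)
    (h₁ : hMinusOneSqW L F g₁ ≤ ENNReal.ofReal C₁) (h₂ : hMinusOneSqW L F g₂ ≤ ENNReal.ofReal C₂) :
    hMinusOneSqW L F (g₁ + g₂) ≤ ENNReal.ofReal ((Real.sqrt C₁ + Real.sqrt C₂) ^ 2) := by
  rw [hMinusOneSqW_le_ofReal_iff (sq_nonneg _)]
  rw [hMinusOneSqW_le_ofReal_iff hC₁] at h₁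
  rw [hMinusOneSqW_le_ofReal_iff hC₂] at h₂
  intro φ hφ
  have hi₁ : Integrable (fun X => g₁ X * φ X * F X ^ 2) (volume.restrict (cellN N L)) :=
    integrableOn_cellN ((hg₁.mul hφ.continuous).mul (hF.pow 2)) L
  have hi₂ : Integrable (fun X => g₂ X * φ X * F X ^ 2) (volume.restrict (cellN N L)) :=
    integrableOn_cellN ((hg₂.mul hφ.continuous).mul (hF.pow 2)) L
  have hsplit : (∫ X in cellN N L, (g₁ + g₂) X * φ X * F X ^ 2) =
      (∫ X in cellN N L, g₁ X * φ X * F X ^ 2) + ∫ X in cellN N L, g₂ X * φ X * F X ^ 2 := by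
    rw [← integral_add hi₁ hi₂]
    refine integral_congr_ae (ae_of_all _ fun X => ?_)
    simp only [Pi.add_apply]
    ring
  set a₁ : ℝ := ∫ X in cellN N L, g₁ X * φ X * F X ^ 2
  set a₂ : ℝ := ∫ X in cellN N L, g₂ X * φ X * F X ^ 2
  set D : ℝ := dirichletFormW L F φ φ
  have hD : 0 ≤ D := dirichletFormW_self_nonneg L F φ
  have e₁ : a₁ ^ 2 ≤ C₁ * D := h₁ φ hφ
  have e₂ : a₂ ^ 2 ≤ C₂ * D := h₂ φ hφ
  have b₁ : |a₁| ≤ Real.sqrt C₁ * Real.sqrt D := by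
    rw [← Real.sqrt_sq_eq_abs, ← Real.sqrt_mul hC₁]
    exact Real.sqrt_le_sqrt e₁
  have b₂ : |a₂| ≤ Real.sqrt C₂ * Real.sqrt D := by
    rw [← Real.sqrt_sq_eq_abs, ← Real.sqrt_mul hC₂]
    exact Real.sqrt_le_sqrt e₂
  rw [hsplit]
  have hsD : Real.sqrt D ^ 2 = D := Real.sq_sqrt hD
  have hab : |a₁ + a₂| ≤ (Real.sqrt C₁ + Real.sqrt C₂) * Real.sqrt D :=
    (abs_add_le a₁ a₂).trans (by nlinarith)
  have h0 : 0 ≤ (Real.sqrt C₁ + Real.sqrt C₂) * Real.sqrt D := by positivity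
  calc (a₁ + a₂) ^ 2 = |a₁ + a₂| ^ 2 := (sq_abs _).symm
    _ ≤ ((Real.sqrt C₁ + Real.sqrt C₂) * Real.sqrt D) ^ 2 :=
        pow_le_pow_left₀ (abs_nonneg _) hab 2
    _ = (Real.sqrt C₁ + Real.sqrt C₂) ^ 2 * D := by rw [mul_pow, hsD]

/-- `‖-g‖²₋₁ = ‖g‖²₋₁`. [folklore] -/
theorem hMinusOneSqW_neg (L : ℝ) (F g : Config N → ℝ) :
    hMinusOneSqW L F (-g) = hMinusOneSqW L F g := by
  have h := hMinusOneSqW_smul (-1) L F g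
  rw [neg_one_smul] at h
  simp [h]

/-! ## §2  The phase of particle `j` and the flow potential `f = -(∑ⱼ cos θ(xⱼ))/|p|` -/

/-- The phase `θ_k(xⱼ) = (2π/L) k·xⱼ` of particle `j`, as a continuous linear functional on
configurations. [folklore] -/
def argN (L : ℝ) (k : Fin 3 → ℤ) (j : Fin N) : Config N →L[ℝ] ℝ :=
  (argCLM L k).comp (ContinuousLinearMap.proj j)

/-- `argN` evaluates to the phase of particle `j`. [folklore] -/
theorem argN_apply (L : ℝ) (k : Fin 3 → ℤ) (j : Fin N) (X : Config N) :
    argN L k j X = arg L k (X j) := by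
  simp [argN, argCLM_apply]

/-- `θ_k` of particle `j` evaluated on the unit vector `e_{i,m}`: `δ_{ij} (2π/L) k_m`. [folklore] -/
theorem argN_single (L : ℝ) (k : Fin 3 → ℤ) (j i : Fin N) (m : Fin 3) :
    argN L k j (Pi.single i (EuclideanSpace.single m (1 : ℝ)) : Config N) =
      if j = i then 2 * Real.pi / L * k m else 0 := by
  simp only [argN, ContinuousLinearMap.comp_apply, ContinuousLinearMap.proj_apply]
  by_cases h : j = i
  · subst h
    rw [Pi.single_eq_same, argCLM_single, if_pos rfl]
  · rw [Pi.single_eq_of_ne h, map_zero, if_neg h]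

/-- The density wave `V_p(X) = ∑ⱼ cos θ_k(xⱼ)`; by `rfl` the crux's `∑ⱼ cos(2π/L ∑ᵢ kᵢ xⱼᵢ)`. [folklore] -/
def densityWave (L : ℝ) (k : Fin 3 → ℤ) (X : Config N) : ℝ :=
  ∑ j : Fin N, Real.cos (arg L k (X j))

/-- **The flow potential** `f(X) = -|p|⁻¹ ∑ⱼ cos θ_k(xⱼ)`, whose gradient is the free displacement
flow `Yⱼ = sin θ_k(xⱼ) p̂` of the card and whose Laplacian is `|p| V_p`. [card uv-thomson-force-wave] -/
def flowPot (L : ℝ) (k : Fin 3 → ℤ) (X : Config N) : ℝ :=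
  -((Real.sqrt (psq L k))⁻¹ * densityWave L k X)

/-- Chain rule: `d cos θ_k(xⱼ) = -sin θ_k(xⱼ) dθ_k(xⱼ)`. [folklore] -/
theorem hasFDerivAt_cos_argN (L : ℝ) (k : Fin 3 → ℤ) (j : Fin N) (X : Config N) :
    HasFDerivAt (fun Y : Config N => Real.cos (arg L k (Y j)))
      ((-Real.sin (arg L k (X j))) • (argN L k j : Config N →L[ℝ] ℝ)) X := by
  have hfun : (fun Y : Config N => Real.cos (arg L k (Y j))) = Real.cos ∘ (argN L k j) := by
    funext Y; simp [argN_apply]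
  rw [hfun, ← argN_apply]
  exact (Real.hasDerivAt_cos (argN L k j X)).comp_hasFDerivAt X (argN L k j).hasFDerivAt

/-- Chain rule: `d sin θ_k(xⱼ) = cos θ_k(xⱼ) dθ_k(xⱼ)`. [folklore] -/
theorem hasFDerivAt_sin_argN (L : ℝ) (k : Fin 3 → ℤ) (j : Fin N) (X : Config N) :
    HasFDerivAt (fun Y : Config N => Real.sin (arg L k (Y j)))
      ((Real.cos (arg L k (X j))) • (argN L k j : Config N →L[ℝ] ℝ)) X := by
  have hfun : (fun Y : Config N => Real.sin (arg L k (Y j))) = Real.sin ∘ (argN L k j) := by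
    funext Y; simp [argN_apply]
  rw [hfun, ← argN_apply]
  exact (Real.hasDerivAt_sin (argN L k j X)).comp_hasFDerivAt X (argN L k j).hasFDerivAt

/-- `∂_{i,m} cos θ_k(xⱼ) = -δ_{ij} sin θ_k(xⱼ) (2π/L) k_m`. [folklore] -/
theorem pderiv_cos_arg (L : ℝ) (k : Fin 3 → ℤ) (j i : Fin N) (m : Fin 3) (X : Config N) :
    pderiv i m (fun Y : Config N => Real.cos (arg L k (Y j))) X =
      if j = i then -Real.sin (arg L k (X j)) * (2 * Real.pi / L * k m) else 0 := by
  unfold pderiv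
  rw [(hasFDerivAt_cos_argN L k j X).fderiv, _root_.smul_apply, argN_single,
    smul_eq_mul]
  split_ifs <;> simp

/-- `∂_{i,m} sin θ_k(xⱼ) = δ_{ij} cos θ_k(xⱼ) (2π/L) k_m`. [folklore] -/
theorem pderiv_sin_arg (L : ℝ) (k : Fin 3 → ℤ) (j i : Fin N) (m : Fin 3) (X : Config N) :
    pderiv i m (fun Y : Config N => Real.sin (arg L k (Y j))) X =
      if j = i then Real.cos (arg L k (X j)) * (2 * Real.pi / L * k m) else 0 := by
  unfold pderiv
  rw [(hasFDerivAt_sin_argN L k j X).fderiv, _root_.smul_apply, argN_single,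
    smul_eq_mul]
  split_ifs <;> simp

/-- Smoothness of `cos θ_k(xⱼ)` as a function of the configuration. [folklore] -/
theorem contDiff_cos_arg (L : ℝ) (k : Fin 3 → ℤ) (j : Fin N) {n : WithTop ℕ∞} :
    ContDiff ℝ n (fun Y : Config N => Real.cos (arg L k (Y j))) := by
  rw [show (fun Y : Config N => Real.cos (arg L k (Y j))) = fun Y => Real.cos (argN L k j Y) from
    funext fun Y => by rw [argN_apply]]
  exact Real.contDiff_cos.comp (argN L k j).contDiff

/-- Smoothness of `sin θ_k(xⱼ)` as a function of the configuration. [folklore] -/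
theorem contDiff_sin_arg (L : ℝ) (k : Fin 3 → ℤ) (j : Fin N) {n : WithTop ℕ∞} :
    ContDiff ℝ n (fun Y : Config N => Real.sin (arg L k (Y j))) := by
  rw [show (fun Y : Config N => Real.sin (arg L k (Y j))) = fun Y => Real.sin (argN L k j Y) from
    funext fun Y => by rw [argN_apply]]
  exact Real.contDiff_sin.comp (argN L k j).contDiff

/-- The density wave is smooth. [folklore] -/
theorem contDiff_densityWave (L : ℝ) (k : Fin 3 → ℤ) {n : WithTop ℕ∞} :
    ContDiff ℝ n (densityWave (N := N) L k) := by
  unfold densityWave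
  exact ContDiff.sum fun j _ => contDiff_cos_arg L k j

/-- The flow potential is smooth. [folklore] -/
theorem contDiff_flowPot (L : ℝ) (k : Fin 3 → ℤ) {n : WithTop ℕ∞} :
    ContDiff ℝ n (flowPot (N := N) L k) := by
  unfold flowPot
  exact (contDiff_const.mul (contDiff_densityWave L k)).neg

/-- The density wave is continuous. [folklore] -/
theorem continuous_densityWave (L : ℝ) (k : Fin 3 → ℤ) : Continuous (densityWave (N := N) L k) :=
  (contDiff_densityWave L k (n := 0)).continuous

/-- `V_p` is lattice periodic (`k ∈ ℤ³`). [folklore] -/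
theorem isLatticePeriodic_densityWave {L : ℝ} (hL : L ≠ 0) (k : Fin 3 → ℤ) :
    IsLatticePeriodic L (densityWave (N := N) L k) := by
  intro X i m
  unfold densityWave
  refine Finset.sum_congr rfl fun j _ => ?_
  by_cases h : j = i
  · subst h
    rw [Pi.add_apply, Pi.single_eq_same, arg_add_single hL,
      show arg L k (X j) + 2 * Real.pi * (k m : ℝ) = arg L k (X j) + ((k m : ℤ) : ℝ) * (2 * Real.pi) by ring,
      Real.cos_add_int_mul_two_pi]
  · rw [Pi.add_apply, Pi.single_eq_of_ne h, add_zero]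

/-- The flow potential is lattice periodic. [folklore] -/
theorem isLatticePeriodic_flowPot {L : ℝ} (hL : L ≠ 0) (k : Fin 3 → ℤ) :
    IsLatticePeriodic L (flowPot (N := N) L k) := fun X i m => by
  simp only [flowPot, isLatticePeriodic_densityWave hL k X i m]


/-! ## §3  Calculus of the flow potential: `∇f = Y`, `Δf = |p| V_p`, `|∇f|² = ∑ⱼ sin² θ(xⱼ)` -/

/-- `∂_{i,m} V_p = -sin θ_k(xᵢ) (2π/L) k_m`. [folklore] -/
theorem pderiv_densityWave (L : ℝ) (k : Fin 3 → ℤ) (i : Fin N) (m : Fin 3) (X : Config N) :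
    pderiv i m (densityWave L k) X = -Real.sin (arg L k (X i)) * (2 * Real.pi / L * k m) := by
  have hd : ∀ j : Fin N, DifferentiableAt ℝ (fun Y : Config N => Real.cos (arg L k (Y j))) X :=
    fun j => ((contDiff_cos_arg L k j (n := 1)).differentiable (by simp)) X
  have h : pderiv i m (densityWave L k) X =
      ∑ j : Fin N, pderiv i m (fun Y : Config N => Real.cos (arg L k (Y j))) X := by
    unfold pderiv densityWave
    rw [show (fun Y : Config N => ∑ j : Fin N, Real.cos (arg L k (Y j))) =
        ∑ j : Fin N, fun Y : Config N => Real.cos (arg L k (Y j)) from by funext Y; simp,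
      fderiv_sum fun j _ => hd j, _root_.sum_apply]
  rw [h]
  simp only [pderiv_cos_arg]
  rw [Finset.sum_ite_eq' Finset.univ i, if_pos (Finset.mem_univ i)]

/-- `∂_{i,m} f = |p|⁻¹ sin θ_k(xᵢ) (2π/L) k_m` (`= sin θ_k(xᵢ) p̂_m` for `L > 0`, see
`pderiv_flowPot_eq_khat`). [folklore] -/
theorem pderiv_flowPot (L : ℝ) (k : Fin 3 → ℤ) (i : Fin N) (m : Fin 3) (X : Config N) :
    pderiv i m (flowPot L k) X =
      (Real.sqrt (psq L k))⁻¹ * (Real.sin (arg L k (X i)) * (2 * Real.pi / L * k m)) := by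
  have h1 : flowPot (N := N) L k = fun Y => -((Real.sqrt (psq L k))⁻¹ • densityWave L k) Y := by
    funext Y; simp [flowPot]
  rw [h1, pderiv_fun_neg, pderiv_const_smul, pderiv_densityWave]
  ring

/-- For `L > 0`: `(2π/L) k_m / |p| = p̂_m = k_m/|k|`. [folklore] -/
theorem coeff_eq_khat {L : ℝ} (hL : 0 < L) (k : Fin 3 → ℤ) (m : Fin 3) :
    (Real.sqrt (psq L k))⁻¹ * (2 * Real.pi / L * k m) = UvThomsonStubs.khat k m := by
  unfold UvThomsonStubs.khat psq
  have h2 : 0 < 2 * Real.pi / L := by positivity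
  rw [Real.sqrt_mul (sq_nonneg _), Real.sqrt_sq h2.le]
  rcases eq_or_ne (Real.sqrt (∑ l, (k l : ℝ) ^ 2)) 0 with h0 | h0
  · -- then `k = 0` componentwise and both sides vanish
    have hsum : ∑ l, (k l : ℝ) ^ 2 = 0 := by
      have hnn : 0 ≤ ∑ l, (k l : ℝ) ^ 2 := Finset.sum_nonneg fun l _ => sq_nonneg _
      rcases hnn.lt_or_eq with hlt | heq
      · exact absurd h0 (Real.sqrt_pos.mpr hlt).ne'
      · exact heq.symm
    have hkm : (k m : ℝ) = 0 := by
      have := (Finset.sum_eq_zero_iff_of_nonneg fun l _ => sq_nonneg (k l : ℝ)).mp hsum m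
        (Finset.mem_univ m)
      exact pow_eq_zero_iff (n := 2) (by norm_num) |>.mp this
    simp [hkm]
  · field_simp

/-- **`∇f = Y`**: for `L > 0` the gradient of the flow potential is the free displacement flow,
`∂_{i,m} f (X) = sin θ_k(xᵢ) p̂_m`. [card uv-thomson-force-wave] -/
theorem pderiv_flowPot_eq_khat {L : ℝ} (hL : 0 < L) (k : Fin 3 → ℤ) (i : Fin N) (m : Fin 3)
    (X : Config N) :
    pderiv i m (flowPot L k) X = Real.sin (arg L k (X i)) * UvThomsonStubs.khat k m := by
  rw [pderiv_flowPot, ← coeff_eq_khat hL k m]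
  ring

/-- `∑ₘ ((2π/L) k_m)² = |p|²`. [folklore] -/
theorem sum_coeff_sq (L : ℝ) (k : Fin 3 → ℤ) :
    ∑ m : Fin 3, (2 * Real.pi / L * k m) ^ 2 = psq L k := by
  unfold psq
  rw [Finset.mul_sum]
  refine Finset.sum_congr rfl fun m _ => ?_
  ring

/-- `∑ₘ p̂_m² = 1` for `k ≠ 0`. [folklore] -/
theorem sum_khat_sq {k : Fin 3 → ℤ} (hk : k ≠ 0) : ∑ m : Fin 3, UvThomsonStubs.khat k m ^ 2 = 1 := by
  unfold UvThomsonStubs.khat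
  have hpos : 0 < ∑ l, (k l : ℝ) ^ 2 := by
    obtain ⟨i, hi⟩ : ∃ i, k i ≠ 0 := by
      by_contra h
      push Not at h
      exact hk (funext h)
    have hi' : (0 : ℝ) < (k i : ℝ) ^ 2 := by
      have : (k i : ℝ) ≠ 0 := by exact_mod_cast hi
      positivity
    exact lt_of_lt_of_le hi'
      (Finset.single_le_sum (f := fun l => (k l : ℝ) ^ 2) (fun l _ => sq_nonneg _) (Finset.mem_univ i))
  have hs : Real.sqrt (∑ l, (k l : ℝ) ^ 2) ^ 2 = ∑ l, (k l : ℝ) ^ 2 := Real.sq_sqrt hpos.le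
  simp_rw [div_pow, hs, ← Finset.sum_div]
  exact div_self hpos.ne'

/-- **`|∇f|² = ∑ⱼ sin² θ_k(xⱼ)`** (`L > 0`, `k ≠ 0`): the energy density of the free flow.
[card uv-thomson-force-wave] -/
theorem gradDot_flowPot_self {L : ℝ} (hL : 0 < L) {k : Fin 3 → ℤ} (hk : k ≠ 0) (X : Config N) :
    gradDot (flowPot L k) (flowPot L k) X = ∑ j : Fin N, Real.sin (arg L k (X j)) ^ 2 := by
  unfold gradDot
  refine Finset.sum_congr rfl fun j _ => ?_
  simp_rw [pderiv_flowPot_eq_khat hL, show ∀ m : Fin 3,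
    Real.sin (arg L k (X j)) * UvThomsonStubs.khat k m * (Real.sin (arg L k (X j)) *
      UvThomsonStubs.khat k m) = Real.sin (arg L k (X j)) ^ 2 * UvThomsonStubs.khat k m ^ 2 from
    fun m => by ring, ← Finset.mul_sum, sum_khat_sq hk, mul_one]

/-- `|∇f|² ≤ N` pointwise. [folklore] -/
theorem gradDot_flowPot_self_le {L : ℝ} (hL : 0 < L) {k : Fin 3 → ℤ} (hk : k ≠ 0) (X : Config N) :
    gradDot (flowPot L k) (flowPot L k) X ≤ N := by
  rw [gradDot_flowPot_self hL hk]
  calc ∑ j : Fin N, Real.sin (arg L k (X j)) ^ 2 ≤ ∑ _j : Fin N, (1 : ℝ) :=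
        Finset.sum_le_sum fun j _ => by
          rw [sq_le_one_iff_abs_le_one]; exact Real.abs_sin_le_one _
    _ = N := by simp

/-- Second partials: `∂_{i,m}∂_{i,m} f = |p|⁻¹ cos θ_k(xᵢ) ((2π/L) k_m)²`. [folklore] -/
theorem pderiv_pderiv_flowPot (L : ℝ) (k : Fin 3 → ℤ) (i : Fin N) (m : Fin 3) (X : Config N) :
    pderiv i m (pderiv i m (flowPot L k)) X =
      (Real.sqrt (psq L k))⁻¹ * (Real.cos (arg L k (X i)) * (2 * Real.pi / L * k m) ^ 2) := by
  have h1 : pderiv i m (flowPot (N := N) L k) =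
      ((Real.sqrt (psq L k))⁻¹ * (2 * Real.pi / L * k m)) •
        (fun Z : Config N => Real.sin (arg L k (Z i))) := by
    funext Y
    rw [pderiv_flowPot, Pi.smul_apply, smul_eq_mul]
    ring
  rw [h1, pderiv_const_smul, pderiv_sin_arg, if_pos rfl]
  ring

/-- **`Δf = |p| V_p`**: the Laplacian of the flow potential is `|p|` times the density wave.
[card uv-thomson-force-wave] -/
theorem configLaplacian_flowPot (L : ℝ) (k : Fin 3 → ℤ) (X : Config N) :
    configLaplacian (flowPot L k) X = Real.sqrt (psq L k) * densityWave L k X := by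
  unfold configLaplacian densityWave
  rw [Finset.mul_sum]
  refine Finset.sum_congr rfl fun i _ => ?_
  simp_rw [pderiv_pderiv_flowPot, ← Finset.mul_sum, sum_coeff_sq]
  rcases eq_or_ne (psq L k) 0 with h0 | h0
  · simp [h0]
  · have hp : 0 < psq L k := lt_of_le_of_ne (psq_nonneg L k) (Ne.symm h0)
    have hs : Real.sqrt (psq L k) ≠ 0 := (Real.sqrt_pos.mpr hp).ne'
    have hss : Real.sqrt (psq L k) * Real.sqrt (psq L k) = psq L k := Real.mul_self_sqrt hp.le
    have key : (Real.sqrt (psq L k))⁻¹ * psq L k = Real.sqrt (psq L k) :=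
      ((eq_inv_mul_iff_mul_eq₀ hs).mpr hss).symm
    rw [show (Real.sqrt (psq L k))⁻¹ * (Real.cos (arg L k (X i)) * psq L k) =
        Real.cos (arg L k (X i)) * ((Real.sqrt (psq L k))⁻¹ * psq L k) by ring, key]
    ring

/-- `|p|² > 0` for `k ≠ 0`, `L ≠ 0`. [folklore] -/
theorem psq_pos {L : ℝ} (hL : L ≠ 0) {k : Fin 3 → ℤ} (hk : k ≠ 0) : 0 < psq L k := by
  rw [← sum_coeff_sq]
  obtain ⟨i, hi⟩ : ∃ i, k i ≠ 0 := by
    by_contra h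
    push Not at h
    exact hk (funext h)
  have hi' : (0 : ℝ) < (2 * Real.pi / L * k i) ^ 2 := by
    have h1 : (2 * Real.pi / L * k i : ℝ) ≠ 0 := by
      have : (k i : ℝ) ≠ 0 := by exact_mod_cast hi
      have : 2 * Real.pi / L ≠ 0 := div_ne_zero (by positivity) hL
      positivity
    positivity
  exact lt_of_lt_of_le hi' (Finset.single_le_sum (f := fun m => (2 * Real.pi / L * (k m : ℝ)) ^ 2)
    (fun m _ => sq_nonneg _) (Finset.mem_univ i))

/-- `∑ₘ p̂_m (2π/L) k_m = |p|` for `L > 0`. [folklore] -/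
theorem sum_khat_mul_coeff {L : ℝ} (hL : 0 < L) (k : Fin 3 → ℤ) :
    ∑ m : Fin 3, UvThomsonStubs.khat k m * (2 * Real.pi / L * k m) = Real.sqrt (psq L k) := by
  have h1 : ∑ m : Fin 3, UvThomsonStubs.khat k m * (2 * Real.pi / L * k m) =
      (Real.sqrt (psq L k))⁻¹ * ∑ m : Fin 3, (2 * Real.pi / L * k m) ^ 2 := by
    rw [Finset.mul_sum]
    refine Finset.sum_congr rfl fun m _ => ?_
    rw [← coeff_eq_khat hL k m]
    ring
  rw [h1, sum_coeff_sq]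
  rcases eq_or_ne (psq L k) 0 with h0 | h0
  · rw [h0, Real.sqrt_zero, mul_zero]
  · have hp : 0 < psq L k := lt_of_le_of_ne (psq_nonneg L k) (Ne.symm h0)
    have hs : Real.sqrt (psq L k) ≠ 0 := (Real.sqrt_pos.mpr hp).ne'
    exact ((eq_inv_mul_iff_mul_eq₀ hs).mpr (Real.mul_self_sqrt hp.le)).symm

/-- `∇f·∇φ = ∑ⱼ sin θ_k(xⱼ) p̂·∇ⱼφ` (`L > 0`): pairing a gradient with the free flow. [folklore] -/
theorem gradDot_flowPot_left {L : ℝ} (hL : 0 < L) (k : Fin 3 → ℤ) (φ : Config N → ℝ) (X : Config N) :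
    gradDot (flowPot L k) φ X =
      ∑ j : Fin N, Real.sin (arg L k (X j)) * ∑ m : Fin 3, UvThomsonStubs.khat k m * pderiv j m φ X := by
  unfold gradDot
  refine Finset.sum_congr rfl fun j _ => ?_
  rw [Finset.mul_sum]
  refine Finset.sum_congr rfl fun m _ => ?_
  rw [pderiv_flowPot_eq_khat hL]
  ring

end

end Summit.AtomisticToContinuum.BoseEinsteinCondensation.Theorems.StaticResponseBound.Negative.UvThomsonFlow
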